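import Mathlib
import Literature.Analysis.Quadrature.ScrambledNetVariance

/-!
# Gain coefficients of scrambled nets; the variance formula in dimension `s` (Theorem 13.6)

Let `x_0, …, x_{N-1} ∈ [0,1)ˢ` be points with base-`b` digit sequences `ξ_{n,i}` (point `n`,
coordinate `i`), randomised by Owen's scrambling applied INDEPENDENTLY TO EACH COORDINATE — one
nested uniform scramble `Π_i` per coordinate, the same for all points [Dick–Pillichshammer 2010,
§13.1; `scrambleMeasurePi` of `Literature.Analysis.Quadrature.OwenScrambling`] — and let
`Î(f) = (1/N) Σ_n f(y_n)` be the randomised QMC estimator [DP2010, eq. (13.7)].  For `f` with Walsh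
coefficients `f̂(𝐤)`, `𝐤 = (k_1, …, k_s)`, the nested ANOVA variances are
`σ_𝓵²(f) = Σ_{𝐤 ∈ L_𝓵} |f̂(𝐤)|²`, `L_𝓵 = {𝐤 : k_i has exactly ℓ_i base-b digits}` [DP2010, §13.3.2],
and **Theorem 13.6** of [DP2010] (Owen 1997) states
`Var[Î(f)] = Σ_{𝓵 ≠ 0} G_𝓵 σ_𝓵²(f)`,
`G_𝓵 = N⁻² Σ_{n,n'} ∏_{i=1}^{s} (b χ[⌊b^{ℓ_i} x_{n,i}⌋ = ⌊b^{ℓ_i} x_{n',i}⌋]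
  - χ[⌊b^{ℓ_i-1} x_{n,i}⌋ = ⌊b^{ℓ_i-1} x_{n',i}⌋])/(b-1)`
(factors with `ℓ_i = 0` equal to `1`).  The numbers `Γ_𝓵 = N G_𝓵` are Owen's **gain coefficients**
([Owen1998], eq. (1): `Γ_{u,κ}` with `u = {i : ℓ_i ≥ 1}`, `κ_i = ℓ_i - 1`): `Var[Î(f)] =
N⁻¹ Σ_𝓵 Γ_𝓵 σ_𝓵²(f)` against the Monte Carlo variance `N⁻¹ Σ_𝓵 σ_𝓵²(f)`.  For a `(t, m, s)`-net
in base `b` (`N = b^m`) Owen proved [Owen1998, Lemma 2 and Theorem 1, eq. (12); quoted in DP2010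
after Theorem 13.9, p. 411, and in Lemieux2009, Prop. 6.4]
`Γ_𝓵 = 0` for `0 < |𝓵|_1 ≤ m - t`,  `Γ_𝓵 ≤ b^t ((b+1)/(b-1))^s` always, hence
`Var[Î(f)] ≤ (b^t/N) ((b+1)/(b-1))^s σ²(f)`.

We formalise this on the digit space (`s`-tuples of digit sequences `ι → ℕ → Fin b`, digit `j` in
Lean = digit `j+1` of the book), for `b ≥ 2` (`1 < b`; primality of `b`, assumed in [DP2010, §13.3],
is not needed) and for WALSH POLYNOMIALS `f = Σ_{𝐤 ∈ [0,b^L)ˢ} c_𝐤 wal_𝐤` (`walshPolyPi`;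
`f̂(𝐤) = c_𝐤`, `∫ f = c_0`):

* `digitBlock`, `digitLen`, `lengthClass` (`L_𝓵`), `blockVariancePi` (`σ_𝓵²`), `walshDPi`,
  `scrambleDigitsPi`, `scrambledAveragePi` (`Î`), `prefixInd` (`χ`), `pairGain`, `gainFactorPi`
  (`N² G_𝓵 = N Γ_𝓵`), `boxPairCount` (`M_𝐝`, ordered pairs of points in a common box of shape `𝐝`),
  `lenSupport` (`u(𝓵)`), `refineShape`;
* `integral_walshDPi_scrambleDigitsPi` (`E[wal_𝐤(ζ_Π)] = [𝐤 = 0]`) and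
  `integral_scrambledAveragePi_walshPolyPi` — **unbiasedness** `E[Î(f)] = c_0`
  [DP2010, Prop. 13.1];
* `integral_norm_sq_pointSum` (`E|Σ_n wal_𝐤(y_n)|² = N² G_𝓵` for `𝐤 ∈ L_𝓵`), `gainFactorPi_nonneg`;
* `integral_norm_sq_scrambledAveragePi_sub` (per wavenumber) and
  `integral_norm_sq_scrambledAveragePi_sub_eq_sum` — **Theorem 13.6**:
  `E|Î(f) - c_0|² = N⁻² Σ_{𝓵 ∈ [0,L]ˢ ∖ {0}} (N² G_𝓵) σ_𝓵²(f)`; `sum_norm_sq_eq_sum_blockVariancePi`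
  (`σ² = Σ_𝓵 σ_𝓵²` for Walsh polynomials);
* `gainFactorPi_eq_sum_boxPairCount` — the **subset expansion** [Owen1998, eq. (5)]
  `N² G_𝓵 = (b-1)^{-|u|} Σ_{v ⊆ u} (-1)^{|u∖v|} b^{|v|} M_{d^v}`,
  `d^v = (ℓ_i)_{i ∈ v} ∪ (ℓ_i - 1)_{i ∉ v}`;
* `IsDigitNetPi b t m ξ` — the `(t, m, s)`-net property on the digit space [DP2010, Def. 4.7];
  `IsDigitNetPi.card_filter_box_eq` (fairness at all orders `≤ m - t`, [DP2010, Remark 4.9 (2)]),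
  `IsDigitNetPi.boxPairCount_eq` (`M_𝐝 = b^{2m - |𝐝|_1}`, `|𝐝|_1 ≤ m - t`),
  `IsDigitNetPi.card_filter_box_le` / `boxPairCount_le` (`M_𝐝 ≤ b^{m+t}`, `|𝐝|_1 ≥ m - t`);
* `IsDigitNetPi.gainFactorPi_eq_zero` — **Owen's Lemma 2**: `G_𝓵 = 0` for `0 < |𝓵|_1 ≤ m - t`;
* `IsDigitNetPi.gainFactorPi_le` / `gainFactorPi_le_card_mul` — **Owen's bound**
  `N² G_𝓵 ≤ b^{m+t} ((b+1)/(b-1))^{|u|} ≤ N b^t ((b+1)/(b-1))^s`;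
* `IsDigitNetPi.integral_norm_sq_scrambledAveragePi_sub_eq` (only `|𝓵|_1 > m - t` contribute) and
  `IsDigitNetPi.integral_norm_sq_scrambledAveragePi_sub_le` —
  `E|Î(f) - c_0|² ≤ (b^t/b^m) ((b+1)/(b-1))^s Σ_{𝐤 ≠ 0} |c_𝐤|²` [Owen1998, (12); Lemieux2009,
  Prop. 6.4].

Design.  As in the one-dimensional file `ScrambledNetVariance` (whose `gainFactor`, `IsDigitNet`
are the case `s = 1`), everything is stated where the scrambles act, on digit sequences, with
`walshD` of `Literature.Analysis.Quadrature.DigitalNets`; a `b`-adic box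
`∏_i [A_i b^{-d_i}, (A_i+1) b^{-d_i})` becomes a prescribed digit prefix of length `d_i` in each
coordinate (`digitsPrefix`).  The book proves Theorem 13.6 for `f ∈ L_2([0,1]ˢ)`; the reduction to
the finite Walsh sums treated here is Parseval's identity, not formalised in this file — for a Walsh
polynomial of degree `< b^L` per coordinate all `σ_𝓵²` with some `ℓ_i > L` vanish and the
statements are literally the book's.  The variance is the second moment `E|Î(f) - c_0|²` about
the proved mean.  Proofs: Theorem 13.6 as in the book (expand `|Σ_𝐤 c_𝐤 A_𝐤(Π)|²`,
`A_𝐤(Π) = Σ_n wal_𝐤(y_n)`; the cross terms vanish and the diagonal ones factor over the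
coordinates by independence — Fubini on the product of the scramble laws — and are evaluated by
Owen's lemma,
`integral_walshD_scrambleDigits_mul_conj_eq` / `_of_ne` of `OwenLemma`); the net statements by
Owen's counting argument [Owen1998] for GENERAL `(t, m, s)`-nets: multiply out the product of
differences over the subsets `v` of the support `u`, count the pairs in the refined boxes (`M_{d^v}`
is exactly `b^{2m-|d^v|_1}` when `|d^v|_1 ≤ m - t`, and between `b^m` and `b^{m+t}` otherwise), and
use `Σ_{v ⊆ u} (-1)^{|u∖v|} = 0`, `Σ_{v ⊆ u} b^{|v|} = (b+1)^{|u|}`; for the bound each `M_{d^v}` is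
compared with its fair value `b^{2m}/b^{|d^v|_1}` (deviation `≤ b^{m+t}`), a uniform form of
[Owen1998, Lemma 4, eq. (9)–(10)].  Deliberately NOT here: the `L_2`/Parseval passage, the
digital-net formula `Var = b^{-m} Σ_{𝐤 ∈ 𝓓'_∞} …` (Corollary 13.7, Lemma 13.8, Theorem 13.9,
which need the dual net), the sharper bounds `Γ ≤ e ≐ 2.72` for `t = 0` (Owen 1997) and for
`(λ, t, m, s)`-nets ([Owen1998], eq. (13)–(14)), and the smooth-integrand rates of §13.4.

## References

* J. Dick, F. Pillichshammer, *Digital Nets and Sequences. Discrepancy Theory and Quasi–Monte Carlo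
  Integration*, Cambridge University Press 2010: §4.2 Definition 4.7, Remark 4.9; §13.1
  Proposition 13.1, eq. (13.7); §13.3.1 Lemma 13.3; §13.3.2 Theorem 13.6 (and the remark after
  Theorem 13.9, p. 411); Appendix A, Definition A.3. [DickPillichshammer2010, Thm. 13.6]
* A. B. Owen, *Scrambling Sobol' and Niederreiter–Xing points*, J. Complexity 14 (1998), 466–489,
  doi:10.1006/jcom.1998.0487: eq. (1), (3)–(5), Lemma 2, Lemma 4 (eq. (8)–(10)), Theorem 1
  (eq. (11)–(12)). [Owen1998, Thm. 1]
* A. B. Owen, *Monte Carlo variance of scrambled net quadrature*, SIAM J. Numer. Anal. 34 (1997),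
  1884–1910 (the original of Theorem 13.6; cited through [DP2010, ref. 207]).
* C. Lemieux, *Monte Carlo and Quasi-Monte Carlo Sampling*, Springer 2009, Proposition 6.4
  (`Var(μ̂_scr) ≤ (b^t/n) ((b+1)/(b-1))^s σ²`). [Lemieux2009, Prop. 6.4]

AI-produced formalisation (H21 engines group, seat eng-quad-1, 2026-08-21); no facts, no axioms
beyond Mathlib's, no `sorry`.
-/

open MeasureTheory Complex Finset
open scoped ENNReal ComplexConjugate

noncomputable section

namespace Literature.Analysis.Quadrature

variable (b : ℕ)

/-! ### Digit lengths and the digit-length blocks of wavenumbers -/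

/-- The wavenumbers with exactly `l` base-`b` digits, `{k : b^{l-1} ≤ k < b^l}` for `l ≥ 1` and
`{0}` for `l = 0` — the index blocks of the nested ANOVA variances `σ_ℓ²`
[cite: DickPillichshammer2010, eq. (13.5)] (and §13.3.2, p. 407: "`𝓵 = (ℓ_1, …, ℓ_s)` such
that `k_i` has `ℓ_i` digits"; `κ_i + 1` of [cite: Owen1998, eq. (1)]). -/
def digitBlock (l : ℕ) : Finset ℕ :=
  if l = 0 then {0} else Ico (b ^ (l - 1)) (b ^ l)

/-- The number of base-`b` digits of `k` (`0` for `k = 0`): `k` has `ℓ` digits iff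
`b^{ℓ-1} ≤ k < b^ℓ` [cite: DickPillichshammer2010, Thm. 13.6] (the notation `ℓ_i` = number
of digits of `k_i`, §13.3.2, p. 407; `κ_i + 1` of [cite: Owen1998, eq. (1)]). -/
def digitLen (k : ℕ) : ℕ :=
  if k = 0 then 0 else Nat.log b k + 1

variable {b}

/-- `digitBlock b 0 = {0}`. [folklore] -/
private theorem mem_digitBlock_zero {k : ℕ} : k ∈ digitBlock b 0 ↔ k = 0 := by
  simp [digitBlock]

/-- `digitBlock b l = [b^{l-1}, b^l)` for `l ≥ 1`. [folklore] -/
private theorem mem_digitBlock_of_ne_zero {l k : ℕ} (hl : l ≠ 0) :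
    k ∈ digitBlock b l ↔ b ^ (l - 1) ≤ k ∧ k < b ^ l := by
  simp [digitBlock, hl]

/-- Elements of the `l`-th block are `< b^l`. [folklore] -/
private theorem lt_pow_of_mem_digitBlock [NeZero b] {l k : ℕ} (h : k ∈ digitBlock b l) :
    k < b ^ l := by
  rcases eq_or_ne l 0 with rfl | hl
  · rw [mem_digitBlock_zero.1 h, pow_zero]; exact Nat.one_pos
  · exact ((mem_digitBlock_of_ne_zero hl).1 h).2

/-- Elements of a block of positive length are nonzero. [folklore] -/
private theorem ne_zero_of_mem_digitBlock [NeZero b] {l k : ℕ} (hl : l ≠ 0)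
    (h : k ∈ digitBlock b l) : k ≠ 0 := by
  have h1 := ((mem_digitBlock_of_ne_zero hl).1 h).1
  have : 0 < b ^ (l - 1) := Nat.pow_pos (Nat.pos_of_ne_zero (NeZero.ne b))
  omega

/-- `k` lies in the block of its own digit length. [folklore] -/
private theorem mem_digitBlock_digitLen (hb : 1 < b) (k : ℕ) :
    k ∈ digitBlock b (digitLen b k) := by
  unfold digitLen
  rcases eq_or_ne k 0 with rfl | hk
  · simp [digitBlock]
  · rw [if_neg hk, mem_digitBlock_of_ne_zero (Nat.succ_ne_zero _), Nat.succ_sub_one]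
    exact ⟨Nat.pow_log_le_self b hk, Nat.lt_pow_succ_log_self hb k⟩

/-- … and in no other block. [folklore] -/
private theorem digitLen_eq_of_mem_digitBlock (hb : 1 < b) {k l : ℕ} (h : k ∈ digitBlock b l) :
    digitLen b k = l := by
  rcases eq_or_ne l 0 with rfl | hl
  · rw [mem_digitBlock_zero.1 h]; simp [digitLen]
  · haveI : NeZero b := ⟨by omega⟩
    have hk := ne_zero_of_mem_digitBlock hl h
    obtain ⟨h1, h2⟩ := (mem_digitBlock_of_ne_zero hl).1 h
    rw [digitLen, if_neg hk]
    have := Nat.log_eq_of_pow_le_of_lt_pow h1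
      (by rwa [Nat.sub_add_cancel (Nat.one_le_iff_ne_zero.2 hl)])
    omega

/-- `digitLen b k = 0 ↔ k = 0`. [folklore] -/
private theorem digitLen_eq_zero_iff {k : ℕ} : digitLen b k = 0 ↔ k = 0 := by
  unfold digitLen; split_ifs with h <;> simp [h]

/-- `k < b^L` has at most `L` digits. [folklore] -/
private theorem digitLen_le_of_lt_pow {k L : ℕ} (h : k < b ^ L) : digitLen b k ≤ L := by
  unfold digitLen
  split_ifs with hk
  · exact Nat.zero_le _
  · exact Nat.log_lt_of_lt_pow hk h

/-! ### Definitions: multivariate Walsh functions, the estimator, gain coefficients, nets -/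

variable (b)

section Defs

variable {ι : Type*} [Fintype ι]

/-- The multivariate Walsh function `wal_𝐤(η) = ∏_i wal_{k_i}(η_i)` read off an `s`-tuple of
digit sequences. [cite: DickPillichshammer2010, Def. A.3] -/
def walshDPi [NeZero b] (k : ι → ℕ) (η : ι → ℕ → Fin b) : ℂ :=
  ∏ i, walshD b (k i) (η i)

/-- Coordinate-wise nested scrambling `y = (η_{1,Π_1}, …, η_{s,Π_s})` of an `s`-tuple of
digit sequences by `s` nested scrambles [cite: DickPillichshammer2010, Prop. 13.1] ("apply
Owen's scrambling to each coordinate … permutations with different indices mutually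
independent", §13.1). -/
def scrambleDigitsPi (π : ι → Scramble b) (ζ : ι → ℕ → Fin b) : ι → ℕ → Fin b :=
  fun i => scrambleDigits b (π i) (ζ i)

/-- The coincidence indicator `χ[⌊b^w x⌋ = ⌊b^w x'⌋]` of two points of `[0,1)`, on the digit
space: `1` if the first `w` digits agree, else `0` [cite: DickPillichshammer2010, Lemma 13.3]
(display after the proof, p. 404); Owen's `1_{⌊b^{k+1} X_i^j⌋ = ⌊b^{k+1} X_{i'}^j⌋}`
[cite: Owen1998, eq. (1)]. -/
def prefixInd (w : ℕ) (η η' : ℕ → Fin b) : ℕ :=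
  if digitsPrefix b w η = digitsPrefix b w η' then 1 else 0

/-- The one-dimensional pair gain
`(b χ[⌊b^ℓ x⌋ = ⌊b^ℓ x'⌋] - χ[⌊b^{ℓ-1} x⌋ = ⌊b^{ℓ-1} x'⌋])/(b-1)` (`= 1` for `ℓ = 0`), the value
of `E[wal_k(x_Π) conj wal_k(x'_Π)]` for `k` with `ℓ` digits
[cite: DickPillichshammer2010, Lemma 13.3] (second form); the factors in the display for `Γ_𝓵` of
[cite: DickPillichshammer2010, Thm. 13.6] (p. 407) and of [cite: Owen1998, eq. (1)]. -/
def pairGain (l : ℕ) (η η' : ℕ → Fin b) : ℝ :=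
  ((b : ℝ) * prefixInd b l η η' - prefixInd b (l - 1) η η') / ((b : ℝ) - 1)

variable {κ : Type*} [Fintype κ]

/-- The (un-normalised) **gain coefficient** of a family of `N` points `x_0, …, x_{N-1} ∈ [0,1)ˢ`
(given by their digit sequences `ξ n i`) at the digit-length vector `𝓵 = (ℓ_1, …, ℓ_s)`:
`Σ_{n,n'} ∏_{i} (b χ[⌊b^{ℓ_i} x_{n,i}⌋ = ⌊b^{ℓ_i} x_{n',i}⌋]
  - χ[⌊b^{ℓ_i-1} x_{n,i}⌋ = ⌊b^{ℓ_i-1} x_{n',i}⌋])/(b-1)`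
(factors with `ℓ_i = 0` equal to `1`).  This is `N² G_𝓵` for the quantity `G_𝓵` of
[cite: DickPillichshammer2010, Thm. 13.6] and `N Γ_{u,κ}` for Owen's gain coefficient `Γ_{u,κ}`,
`u = {i : ℓ_i ≥ 1}`, `κ_i = ℓ_i - 1` [cite: Owen1998, eq. (1)] (the book's `Γ_𝓵`, pp. 407, 411).
In dimension one it is `gainFactor` of `ScrambledNetVariance`. -/
def gainFactorPi (ℓ : ι → ℕ) (ξ : κ → ι → ℕ → Fin b) : ℝ :=
  ∑ n, ∑ n', ∏ i, pairGain b (ℓ i) (ξ n i) (ξ n' i)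

/-- The randomised QMC estimator `Î(f) = (1/N) Σ_{n<N} f(y_n)` over the scrambled points
`y_n = (x_{n,1,Π_1}, …, x_{n,s,Π_s})`, on the digit space.
[cite: DickPillichshammer2010, eq. (13.7)] -/
def scrambledAveragePi (π : ι → Scramble b) (ξ : κ → ι → ℕ → Fin b)
    (f : (ι → ℕ → Fin b) → ℂ) : ℂ :=
  ((Fintype.card κ : ℂ)⁻¹) * ∑ n, f (scrambleDigitsPi b π (ξ n))

/-- The number `M_𝐝` of ORDERED pairs of points of the family lying in a common `b`-adic box of
shape `𝐝 = (d_1, …, d_s)` (side `b^{-d_i}` in coordinate `i`), i.e. sharing their first `d_i`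
digits in every coordinate `i` — the multivariate version of `M_w` of
[cite: DickPillichshammer2010, Lemma 13.3] (p. 404); Owen's pair counts
`Σ_{i,i'} ∏_r N_{ii'r}` / `W_{ii'r}` [cite: Owen1998, eq. (3)] (with eq. (4)–(5)). -/
def boxPairCount (d : ι → ℕ) (ξ : κ → ι → ℕ → Fin b) : ℕ :=
  (univ.filter fun p : κ × κ =>
    ∀ i, digitsPrefix b (d i) (ξ p.1 i) = digitsPrefix b (d i) (ξ p.2 i)).card

/-- **`(t, m, s)`-net in base `b`**, on the digit space [cite: DickPillichshammer2010, Def. 4.7]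
(with Remark 4.9 (1)): a family of `b^m` points of `[0,1)ˢ`, given by their digit sequences
`ξ n i` (point `n`, coordinate `i`), with `0 ≤ t ≤ m`, such that every `b`-adic elementary box
`∏_i [A_i b^{-d_i}, (A_i + 1) b^{-d_i})` of volume `b^{t-m}` (`Σ_i d_i = m - t`) contains exactly
`b^t` of them — on the digit space, the box is a prescribed digit prefix of length `d_i` in each
coordinate `i`. -/
def IsDigitNetPi (t m : ℕ) (ξ : κ → ι → ℕ → Fin b) : Prop :=
  t ≤ m ∧ Fintype.card κ = b ^ m ∧
    ∀ d : ι → ℕ, ∑ i, d i = m - t → ∀ a : (i : ι) → (Fin (d i) → Fin b),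
      (univ.filter fun n => ∀ i, digitsPrefix b (d i) (ξ n i) = a i).card = b ^ t

/-- The coordinates in which a digit-length vector is positive, Owen's `u = u(𝓵)`
[cite: Owen1998, eq. (1)] (§2.3); [cite: DickPillichshammer2010, Thm. 13.6] (remark after
Theorem 13.9, p. 411: "`Γ_𝓵` … are `0` for all `𝓵 ∈ ℕ_0^s ∖ {0}` with `|𝓵|_1 ≤ m - t`"). -/
def lenSupport (ℓ : ι → ℕ) : Finset ι :=
  univ.filter fun i => ℓ i ≠ 0

variable [DecidableEq ι]

/-- A **Walsh polynomial** of degree `< b^L` in each coordinate on the `s`-dimensional digit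
space, `f = Σ_{𝐤 ∈ [0, b^L)ˢ} c_𝐤 wal_𝐤` (a finite multivariate Walsh series, `f̂(𝐤) = c_𝐤`,
`∫ f = c_0`). [cite: DickPillichshammer2010, Def. A.3] with
[cite: DickPillichshammer2010, eq. (13.4)] -/
def walshPolyPi [NeZero b] (L : ℕ) (c : (ι → ℕ) → ℂ) (η : ι → ℕ → Fin b) : ℂ :=
  ∑ k ∈ Fintype.piFinset (fun _ : ι => range (b ^ L)), c k * walshDPi b k η

/-- The set `L_𝓵` of wavenumbers `𝐤 = (k_1, …, k_s)` such that `k_i` has exactly `ℓ_i` base-`b`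
digits [cite: DickPillichshammer2010, Thm. 13.6] (proof: "`β_𝓵(x) = Σ_{𝐤 ∈ L_𝓵} f̂(𝐤) wal_𝐤(x)`",
p. 407). -/
def lengthClass (ℓ : ι → ℕ) : Finset (ι → ℕ) :=
  Fintype.piFinset fun i => digitBlock b (ℓ i)

/-- The multivariate nested ANOVA variances `σ_𝓵²(f) = Var[β_𝓵] = Σ_{𝐤 ∈ L_𝓵} |f̂(𝐤)|²` of a
function with Walsh coefficients `f̂(𝐤) = c_𝐤` [cite: DickPillichshammer2010, Thm. 13.6]
(§13.3.2, display before the theorem, p. 407). -/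
def blockVariancePi (c : (ι → ℕ) → ℂ) (ℓ : ι → ℕ) : ℝ :=
  ∑ k ∈ lengthClass b ℓ, ‖c k‖ ^ 2

/-- For `v ⊆ u(𝓵)`, the box shape that is "narrow" (`ℓ_i` digits) on `v` and "wide" (`ℓ_i - 1`
digits) off `v` — the boxes counted in the subset expansion of the gain coefficient
[cite: Owen1998, eq. (5)] (`∏_{r ∈ v} N_{ijr} ∏_{r ∈ u-v} W_{ijr}`, eq. (3)–(5)); the products
`∏_i (b χ_{ℓ_i} - χ_{ℓ_i - 1})` of [cite: DickPillichshammer2010, Thm. 13.6] (p. 407) multiplied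
out. -/
def refineShape (ℓ : ι → ℕ) (v : Finset ι) : ι → ℕ :=
  fun i => if i ∈ v then ℓ i else ℓ i - 1

end Defs

variable {b}

/-! ### Elementary properties and the coordinate-wise moments -/

section Basic

variable {ι : Type*} [Fintype ι]

/-- `wal_0 ≡ 1`. [cite: DickPillichshammer2010, Prop. A.9] (with Def. A.3) -/
@[simp] theorem walshDPi_zero [NeZero b] (η : ι → ℕ → Fin b) : walshDPi b 0 η = 1 := by
  simp [walshDPi]

/-- `|wal_𝐤| = 1`. [cite: DickPillichshammer2010, Def. A.3] -/
theorem norm_walshDPi [NeZero b] (k : ι → ℕ) (η : ι → ℕ → Fin b) : ‖walshDPi b k η‖ = 1 := by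
  rw [walshDPi, norm_prod]
  simp [norm_walshD]

/-- `χ_0 = 1`: every two points share their first `0` digits. [folklore] -/
private theorem prefixInd_zero (η η' : ℕ → Fin b) : prefixInd b 0 η η' = 1 := by
  rw [prefixInd, if_pos (Subsingleton.elim _ _)]

/-- The pair gain at `ℓ = 0` is `1`. [folklore] -/
private theorem pairGain_zero (hb : 1 < b) (η η' : ℕ → Fin b) : pairGain b 0 η η' = 1 := by
  have hb' : (b : ℝ) - 1 ≠ 0 := (sub_pos.2 (by exact_mod_cast hb : (1 : ℝ) < b)).ne'
  rw [pairGain, Nat.zero_sub, prefixInd_zero, Nat.cast_one, mul_one, div_self hb']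

/-- The pair gain, cast to `ℂ`. [folklore] -/
private theorem pairGain_cast (l : ℕ) (η η' : ℕ → Fin b) :
    ((pairGain b l η η' : ℝ) : ℂ) =
      ((b : ℂ) * (if digitsPrefix b l η = digitsPrefix b l η' then 1 else 0) -
        (if digitsPrefix b (l - 1) η = digitsPrefix b (l - 1) η' then 1 else 0)) /
        ((b : ℂ) - 1) := by
  unfold pairGain prefixInd
  split_ifs <;> push_cast <;> ring

/-- For a fixed digit sequence, the scrambled digits depend measurably on the scramble.
[folklore] -/
private theorem measurable_scrambleDigits_left (ξ : ℕ → Fin b) :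
    Measurable fun π : Scramble b => scrambleDigits b π ξ :=
  measurable_pi_lambda _ fun k =>
    (measurable_from_top (f := fun p : Equiv.Perm (Fin b) => p (ξ k))).comp
      (measurable_pi_apply (⟨k, digitsPrefix b k ξ⟩ : (k : ℕ) × (Fin k → Fin b)))

omit [Fintype ι] in
/-- `Π ↦ wal_k(ζ_{i,Π_i})` is measurable in the `s`-tuple of scrambles. [folklore] -/
private theorem measurable_walshD_scrambleDigits_apply [NeZero b] (k : ℕ) (ζ : ι → ℕ → Fin b)
    (i : ι) : Measurable fun π : ι → Scramble b => walshD b k (scrambleDigits b (π i) (ζ i)) :=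
  (measurable_walshD k).comp ((measurable_scrambleDigits_left (ζ i)).comp (measurable_pi_apply i))

/-- `Π ↦ wal_𝐤(ζ_Π)` is measurable. [folklore] -/
private theorem measurable_walshDPi_scrambleDigitsPi [NeZero b] (k : ι → ℕ) (ζ : ι → ℕ → Fin b) :
    Measurable fun π : ι → Scramble b => walshDPi b k (scrambleDigitsPi b π ζ) := by
  unfold walshDPi scrambleDigitsPi
  exact Finset.measurable_prod _ fun i _ => measurable_walshD_scrambleDigits_apply (k i) ζ i

/-- A measurable function bounded in norm is integrable against the (probability) law of the
scrambles. [folklore] -/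
private theorem integrablePi_of_norm_le {F : (ι → Scramble b) → ℂ} (hF : Measurable F) {C : ℝ}
    (hC : ∀ π, ‖F π‖ ≤ C) : Integrable F (scrambleMeasurePi b ι) :=
  (integrable_const C).mono' hF.aestronglyMeasurable (ae_of_all _ hC)

/-- One coordinate: `E[wal_k(η_Π) conj wal_k(η'_Π)]` is the pair gain at the digit length of `k`
(Owen's lemma, second form, together with the trivial case `k = 0`).
[cite: DickPillichshammer2010, Lemma 13.3] -/
private theorem integral_walshD_mul_conj_eq_pairGain [NeZero b] (hb : 1 < b) (η η' : ℕ → Fin b)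
    {k l : ℕ} (hk : k ∈ digitBlock b l) :
    ∫ p, walshD b k (scrambleDigits b p η) * conj (walshD b k (scrambleDigits b p η'))
        ∂scrambleMeasure b = ((pairGain b l η η' : ℝ) : ℂ) := by
  rcases eq_or_ne l 0 with rfl | hl
  · rw [mem_digitBlock_zero.1 hk, pairGain_zero hb]
    simp
  · obtain ⟨h1, h2⟩ := (mem_digitBlock_of_ne_zero hl).1 hk
    rw [integral_walshD_scrambleDigits_mul_conj_eq b hb η η' h1 h2, pairGain_cast]

/-- Independence of the coordinate scrambles: the mixed moment of two multivariate Walsh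
functions of two scrambled points factorises over the coordinates (Fubini on the product law).
[cite: DickPillichshammer2010, Prop. 13.1] ("mutually independent", §13.1). -/
private theorem integral_walshDPi_mul_conj [NeZero b] (k k' : ι → ℕ) (ζ ζ' : ι → ℕ → Fin b) :
    ∫ π, walshDPi b k (scrambleDigitsPi b π ζ) * conj (walshDPi b k' (scrambleDigitsPi b π ζ'))
        ∂scrambleMeasurePi b ι =
      ∏ i, ∫ p, walshD b (k i) (scrambleDigits b p (ζ i)) *
        conj (walshD b (k' i) (scrambleDigits b p (ζ' i))) ∂scrambleMeasure b := by
  have h : ∀ π : ι → Scramble b,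
      walshDPi b k (scrambleDigitsPi b π ζ) * conj (walshDPi b k' (scrambleDigitsPi b π ζ')) =
        ∏ i, walshD b (k i) (scrambleDigits b (π i) (ζ i)) *
          conj (walshD b (k' i) (scrambleDigits b (π i) (ζ' i))) := by
    intro π
    simp only [walshDPi, scrambleDigitsPi, map_prod, Finset.prod_mul_distrib]
  simp_rw [h, scrambleMeasurePi]
  exact integral_fintype_prod_eq_prod (𝕜 := ℂ)
    (fun i (p : Scramble b) => walshD b (k i) (scrambleDigits b p (ζ i)) *
      conj (walshD b (k' i) (scrambleDigits b p (ζ' i))))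

/-- Off the diagonal (`𝐤 ≠ 𝐤'`) the mixed moments vanish, by Owen's lemma in a coordinate where
`k_i ≠ k'_i`. [cite: DickPillichshammer2010, Lemma 13.3] with
[cite: DickPillichshammer2010, Thm. 13.6] (proof: "mutual independence", p. 407). -/
private theorem integral_walshDPi_mul_conj_of_ne [NeZero b] (hb : 1 < b) {k k' : ι → ℕ}
    (hkk : k ≠ k') (ζ ζ' : ι → ℕ → Fin b) :
    ∫ π, walshDPi b k (scrambleDigitsPi b π ζ) * conj (walshDPi b k' (scrambleDigitsPi b π ζ'))
        ∂scrambleMeasurePi b ι = 0 := by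
  obtain ⟨i, hi⟩ := Function.ne_iff.1 hkk
  rw [integral_walshDPi_mul_conj]
  exact Finset.prod_eq_zero (Finset.mem_univ i)
    (integral_walshD_scrambleDigits_mul_conj_of_ne b hb _ _ hi)

/-- On the diagonal, for `𝐤 ∈ L_𝓵`, the moment is the product of the coordinate pair gains
[cite: DickPillichshammer2010, Thm. 13.6] (proof, the display for `Γ_𝓵`, p. 407). -/
private theorem integral_walshDPi_mul_conj_self [NeZero b] (hb : 1 < b) {k ℓ : ι → ℕ}
    (hk : ∀ i, k i ∈ digitBlock b (ℓ i)) (ζ ζ' : ι → ℕ → Fin b) :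
    ∫ π, walshDPi b k (scrambleDigitsPi b π ζ) * conj (walshDPi b k (scrambleDigitsPi b π ζ'))
        ∂scrambleMeasurePi b ι = ((∏ i, pairGain b (ℓ i) (ζ i) (ζ' i) : ℝ) : ℂ) := by
  rw [integral_walshDPi_mul_conj, Complex.ofReal_prod]
  exact Finset.prod_congr rfl fun i _ => integral_walshD_mul_conj_eq_pairGain hb _ _ (hk i)

end Basic

/-! ### Unbiasedness and Theorem 13.6 -/

section Family

variable {ι : Type*} [Fintype ι] {κ : Type*} [Fintype κ]

/-- `E[wal_𝐤(ζ_Π)] = [𝐤 = 0]` for a point scrambled coordinate-wise by independent nested uniform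
scrambles [cite: DickPillichshammer2010, Prop. 13.1] with
[cite: DickPillichshammer2010, Prop. A.10]. -/
theorem integral_walshDPi_scrambleDigitsPi [NeZero b] (hb : 1 < b) (ζ : ι → ℕ → Fin b)
    (k : ι → ℕ) :
    ∫ π, walshDPi b k (scrambleDigitsPi b π ζ) ∂scrambleMeasurePi b ι =
      if k = 0 then 1 else 0 := by
  have h := integral_walshDPi_mul_conj k 0 ζ ζ
  simp only [walshDPi_zero, map_one, mul_one, Pi.zero_apply, walshD_zero,
    integral_walshD_scrambleDigits b hb, Fintype.prod_boole] at h
  rw [h]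
  exact if_congr funext_iff.symm rfl rfl

/-- The point sums `A_𝐤(Π) = Σ_n wal_𝐤(ξ_{n,Π})` are measurable. [folklore] -/
private theorem measurable_pointSum [NeZero b] (k : ι → ℕ) (ξ : κ → ι → ℕ → Fin b) :
    Measurable fun π : ι → Scramble b => ∑ n, walshDPi b k (scrambleDigitsPi b π (ξ n)) :=
  Finset.measurable_sum _ fun n _ => measurable_walshDPi_scrambleDigitsPi k (ξ n)

/-- `|A_𝐤(Π)| ≤ N`. [folklore] -/
private theorem norm_pointSum_le [NeZero b] (k : ι → ℕ) (ξ : κ → ι → ℕ → Fin b)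
    (π : ι → Scramble b) :
    ‖∑ n, walshDPi b k (scrambleDigitsPi b π (ξ n))‖ ≤ Fintype.card κ := by
  calc ‖∑ n, walshDPi b k (scrambleDigitsPi b π (ξ n))‖
      ≤ ∑ n : κ, ‖walshDPi b k (scrambleDigitsPi b π (ξ n))‖ := norm_sum_le _ _
    _ = ∑ n : κ, (1 : ℝ) := by simp_rw [norm_walshDPi]
    _ = Fintype.card κ := by simp

/-- `Π ↦ A_𝐤(Π) conj A_{𝐤'}(Π)` is integrable. [folklore] -/
private theorem integrable_pointSum_mul_conj [NeZero b] (k k' : ι → ℕ) (ξ : κ → ι → ℕ → Fin b) :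
    Integrable (fun π : ι → Scramble b => (∑ n, walshDPi b k (scrambleDigitsPi b π (ξ n))) *
      conj (∑ n, walshDPi b k' (scrambleDigitsPi b π (ξ n)))) (scrambleMeasurePi b ι) := by
  refine integrablePi_of_norm_le ((measurable_pointSum k ξ).mul
    (continuous_conj.measurable.comp (measurable_pointSum k' ξ)))
    (C := (Fintype.card κ : ℝ) * Fintype.card κ) fun π => ?_
  rw [norm_mul, RCLike.norm_conj]
  exact mul_le_mul (norm_pointSum_le k ξ π) (norm_pointSum_le k' ξ π) (norm_nonneg _)
    (Nat.cast_nonneg _)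

/-- `Π ↦ wal_𝐤(ζ_Π) conj wal_{𝐤'}(ζ'_Π)` is integrable. [folklore] -/
private theorem integrable_walshDPi_mul_conj [NeZero b] (k k' : ι → ℕ) (ζ ζ' : ι → ℕ → Fin b) :
    Integrable (fun π : ι → Scramble b => walshDPi b k (scrambleDigitsPi b π ζ) *
      conj (walshDPi b k' (scrambleDigitsPi b π ζ'))) (scrambleMeasurePi b ι) := by
  refine integrablePi_of_norm_le ((measurable_walshDPi_scrambleDigitsPi k ζ).mul
    (continuous_conj.measurable.comp (measurable_walshDPi_scrambleDigitsPi k' ζ'))) (C := 1)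
    fun π => ?_
  rw [norm_mul, RCLike.norm_conj, norm_walshDPi, norm_walshDPi, mul_one]

/-- Second moments of the point sums: `E[A_𝐤 conj A_{𝐤'}] = Σ_{n,n'} E[wal_𝐤(ξ_{n,Π}) conj
wal_{𝐤'}(ξ_{n',Π})]`. [folklore] -/
private theorem integral_pointSum_mul_conj [NeZero b] (ξ : κ → ι → ℕ → Fin b) (k k' : ι → ℕ) :
    ∫ π, (∑ n, walshDPi b k (scrambleDigitsPi b π (ξ n))) *
        conj (∑ n, walshDPi b k' (scrambleDigitsPi b π (ξ n))) ∂scrambleMeasurePi b ι =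
      ∑ n, ∑ n', ∫ π, walshDPi b k (scrambleDigitsPi b π (ξ n)) *
        conj (walshDPi b k' (scrambleDigitsPi b π (ξ n'))) ∂scrambleMeasurePi b ι := by
  simp_rw [map_sum, Finset.sum_mul_sum]
  rw [integral_finsetSum _ fun n _ =>
    integrable_finsetSum _ fun n' _ => integrable_walshDPi_mul_conj k k' (ξ n) (ξ n')]
  exact Finset.sum_congr rfl fun n _ =>
    integral_finsetSum _ fun n' _ => integrable_walshDPi_mul_conj k k' (ξ n) (ξ n')

/-- Off the diagonal the second moments of the point sums vanish.
[cite: DickPillichshammer2010, Thm. 13.6] (proof). -/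
private theorem integral_pointSum_mul_conj_of_ne [NeZero b] (hb : 1 < b) (ξ : κ → ι → ℕ → Fin b)
    {k k' : ι → ℕ} (hkk : k ≠ k') :
    ∫ π, (∑ n, walshDPi b k (scrambleDigitsPi b π (ξ n))) *
        conj (∑ n, walshDPi b k' (scrambleDigitsPi b π (ξ n))) ∂scrambleMeasurePi b ι = 0 := by
  rw [integral_pointSum_mul_conj ξ k k']
  exact Finset.sum_eq_zero fun n _ => Finset.sum_eq_zero fun n' _ =>
    integral_walshDPi_mul_conj_of_ne hb hkk (ξ n) (ξ n')

/-- On the diagonal, for `𝐤 ∈ L_𝓵`: `E[A_𝐤 conj A_𝐤] = N² G_𝓵` (`= gainFactorPi b 𝓵 ξ`)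
[cite: DickPillichshammer2010, Thm. 13.6] (proof, pp. 407–408). -/
private theorem integral_pointSum_mul_conj_self [NeZero b] (hb : 1 < b) (ξ : κ → ι → ℕ → Fin b)
    {k ℓ : ι → ℕ} (hk : ∀ i, k i ∈ digitBlock b (ℓ i)) :
    ∫ π, (∑ n, walshDPi b k (scrambleDigitsPi b π (ξ n))) *
        conj (∑ n, walshDPi b k (scrambleDigitsPi b π (ξ n))) ∂scrambleMeasurePi b ι =
      (gainFactorPi b ℓ ξ : ℝ) := by
  rw [integral_pointSum_mul_conj ξ k k]
  simp_rw [integral_walshDPi_mul_conj_self hb hk]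
  rw [gainFactorPi]
  push_cast
  rfl

/-- `E|Σ_n wal_𝐤(y_n)|² = N² G_𝓵` for every `𝐤 ∈ L_𝓵`: the gain coefficient is a second moment and
does not depend on the choice of `𝐤` in the class [cite: DickPillichshammer2010, Thm. 13.6]
(proof, "`Var[Σ_n Σ_{𝐤 ∈ L_𝓵} f̂(𝐤) wal_𝐤(y_n)]`", p. 407). -/
theorem integral_norm_sq_pointSum [NeZero b] (hb : 1 < b) (ξ : κ → ι → ℕ → Fin b)
    {k ℓ : ι → ℕ} (hk : ∀ i, k i ∈ digitBlock b (ℓ i)) :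
    ∫ π, ‖∑ n, walshDPi b k (scrambleDigitsPi b π (ξ n))‖ ^ 2 ∂scrambleMeasurePi b ι =
      gainFactorPi b ℓ ξ := by
  apply Complex.ofReal_injective
  rw [← integral_complex_ofReal]
  push_cast
  simp_rw [← Complex.mul_conj']
  exact integral_pointSum_mul_conj_self hb ξ hk

/-- The gain coefficients are nonnegative: `N² G_𝓵 = E|Σ_n wal_𝐤(y_n)|²` for any `𝐤 ∈ L_𝓵`, e.g.
`k_i = b^{ℓ_i - 1}` (`0` if `ℓ_i = 0`). [cite: DickPillichshammer2010, Thm. 13.6] (proof) -/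
theorem gainFactorPi_nonneg [NeZero b] (hb : 1 < b) (ℓ : ι → ℕ) (ξ : κ → ι → ℕ → Fin b) :
    0 ≤ gainFactorPi b ℓ ξ := by
  have hk : ∀ i, (if ℓ i = 0 then 0 else b ^ (ℓ i - 1)) ∈ digitBlock b (ℓ i) := by
    intro i
    by_cases h : ℓ i = 0
    · simp [h, mem_digitBlock_zero]
    · rw [if_neg h, mem_digitBlock_of_ne_zero h]
      exact ⟨le_rfl, Nat.pow_lt_pow_right hb (by omega)⟩
  rw [← integral_norm_sq_pointSum hb ξ (k := fun i => if ℓ i = 0 then 0 else b ^ (ℓ i - 1)) hk]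
  exact integral_nonneg fun _ => by positivity

variable [DecidableEq ι]

/-- **Unbiasedness** of the scrambled estimator on a multivariate Walsh polynomial:
`E[Î(f)] = f̂(0) = ∫ f` [cite: DickPillichshammer2010, Prop. 13.1] (and the display following it in
§13.1, "an unbiased estimator"; here for `f = Σ_{𝐤 ∈ [0,b^L)ˢ} c_𝐤 wal_𝐤` on the digit space, any
point set, independent nested uniform scrambles in the coordinates). -/
theorem integral_scrambledAveragePi_walshPolyPi [NeZero b] (hb : 1 < b) [Nonempty κ]
    (ξ : κ → ι → ℕ → Fin b) (L : ℕ) (c : (ι → ℕ) → ℂ) :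
    ∫ π, scrambledAveragePi b π ξ (walshPolyPi b L c) ∂scrambleMeasurePi b ι = c 0 := by
  have hint : ∀ n k, Integrable
      (fun π : ι → Scramble b => c k * walshDPi b k (scrambleDigitsPi b π (ξ n)))
      (scrambleMeasurePi b ι) := fun n k =>
    (integrablePi_of_norm_le (measurable_walshDPi_scrambleDigitsPi k (ξ n)) (C := 1)
      fun π => (norm_walshDPi _ _).le).const_mul (c k)
  have h0 : (0 : ι → ℕ) ∈ Fintype.piFinset fun _ : ι => range (b ^ L) :=
    Fintype.mem_piFinset.2 fun _ => mem_range.2 (Nat.pow_pos (Nat.pos_of_ne_zero (NeZero.ne b)))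
  simp only [scrambledAveragePi, walshPolyPi]
  rw [integral_const_mul,
    integral_finsetSum _ fun n _ => integrable_finsetSum _ fun k _ => hint n k]
  simp_rw [integral_finsetSum _ fun k _ => hint _ k, integral_const_mul,
    integral_walshDPi_scrambleDigitsPi hb, mul_ite, mul_one, mul_zero, Finset.sum_ite_eq']
  rw [if_pos h0, Finset.sum_const, Finset.card_univ, nsmul_eq_mul, ← mul_assoc,
    inv_mul_cancel₀ (Nat.cast_ne_zero.2 Fintype.card_ne_zero), one_mul]

/-- For `S(Π) = Σ_{𝐤 ≠ 0} c_𝐤 A_𝐤(Π)`: `E|S|² = Σ_{𝐤 ≠ 0} N² G_{𝓵(𝐤)} |c_𝐤|²`, `𝓵(𝐤)` the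
digit-length vector of `𝐤`. [cite: DickPillichshammer2010, Thm. 13.6] (proof) -/
private theorem integral_norm_sq_polySum [NeZero b] (hb : 1 < b) (ξ : κ → ι → ℕ → Fin b) (L : ℕ)
    (c : (ι → ℕ) → ℂ) :
    ∫ π, ‖∑ k ∈ (Fintype.piFinset fun _ : ι => range (b ^ L)).erase 0,
        c k * ∑ n, walshDPi b k (scrambleDigitsPi b π (ξ n))‖ ^ 2 ∂scrambleMeasurePi b ι =
      ∑ k ∈ (Fintype.piFinset fun _ : ι => range (b ^ L)).erase 0,
        gainFactorPi b (fun i => digitLen b (k i)) ξ * ‖c k‖ ^ 2 := by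
  have hint : ∀ k k', Integrable (fun π => (c k * conj (c k')) *
      ((∑ n, walshDPi b k (scrambleDigitsPi b π (ξ n))) *
        conj (∑ n, walshDPi b k' (scrambleDigitsPi b π (ξ n))))) (scrambleMeasurePi b ι) :=
    fun k k' => (integrable_pointSum_mul_conj k k' ξ).const_mul _
  -- pass to `ℂ`, where `|S|² = S conj S`
  apply Complex.ofReal_injective
  rw [← integral_complex_ofReal]
  push_cast
  simp_rw [← Complex.mul_conj', map_sum, map_mul, Finset.sum_mul_sum,
    mul_mul_mul_comm (c _) (∑ n, walshDPi b _ (scrambleDigitsPi b _ (ξ n)))]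
  rw [integral_finsetSum _ fun k _ => integrable_finsetSum _ fun k' _ => hint k k']
  simp_rw [integral_finsetSum _ fun k' _ => hint _ k', integral_const_mul]
  -- the off-diagonal terms vanish
  rw [Finset.sum_congr rfl fun k hk => Finset.sum_eq_single_of_mem k hk fun k' _ hne => by
    rw [integral_pointSum_mul_conj_of_ne hb ξ (Ne.symm hne), mul_zero]]
  -- the diagonal terms
  refine Finset.sum_congr rfl fun k _ => ?_
  rw [integral_pointSum_mul_conj_self hb ξ fun i => mem_digitBlock_digitLen hb (k i),
    Complex.mul_conj', mul_comm]

/-- **Variance of the scrambled estimator, per wavenumber**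
[cite: DickPillichshammer2010, Thm. 13.6] (proof: `Var[Î(f)] = N⁻² Σ_{𝐤 ≠ 0} |f̂(𝐤)|²
E|Σ_n wal_𝐤(y_n)|²`, the cross terms vanishing by the independence of the coordinate scrambles and
Owen's lemma): for a Walsh polynomial `f = Σ_{𝐤 ∈ [0,b^L)ˢ} c_𝐤 wal_𝐤` on the digit space and
ANY `N`-point family scrambled coordinate-wise by independent nested uniform scrambles,
`E|Î(f) - c_0|² = N⁻² Σ_{𝐤 ≠ 0} (N² G_{𝓵(𝐤)}) |c_𝐤|²`. -/
theorem integral_norm_sq_scrambledAveragePi_sub [NeZero b] (hb : 1 < b) [Nonempty κ]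
    (ξ : κ → ι → ℕ → Fin b) (L : ℕ) (c : (ι → ℕ) → ℂ) :
    ∫ π, ‖scrambledAveragePi b π ξ (walshPolyPi b L c) - c 0‖ ^ 2 ∂scrambleMeasurePi b ι =
      ((Fintype.card κ : ℝ) ^ 2)⁻¹ *
        ∑ k ∈ (Fintype.piFinset fun _ : ι => range (b ^ L)).erase 0,
          gainFactorPi b (fun i => digitLen b (k i)) ξ * ‖c k‖ ^ 2 := by
  have hN : (Fintype.card κ : ℂ) ≠ 0 := Nat.cast_ne_zero.2 Fintype.card_ne_zero
  have h0 : (0 : ι → ℕ) ∈ Fintype.piFinset fun _ : ι => range (b ^ L) :=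
    Fintype.mem_piFinset.2 fun _ => mem_range.2 (Nat.pow_pos (Nat.pos_of_ne_zero (NeZero.ne b)))
  -- `Σ_n f(ξ_{n,Π}) = N c_0 + S(Π)`, so `Î(f) - c_0 = S(Π)/N`
  have hS : ∀ π : ι → Scramble b, scrambledAveragePi b π ξ (walshPolyPi b L c) - c 0 =
      (Fintype.card κ : ℂ)⁻¹ * ∑ k ∈ (Fintype.piFinset fun _ : ι => range (b ^ L)).erase 0,
        c k * ∑ n, walshDPi b k (scrambleDigitsPi b π (ξ n)) := by
    intro π
    simp only [scrambledAveragePi, walshPolyPi]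
    rw [Finset.sum_comm, ← Finset.add_sum_erase _ _ h0]
    simp_rw [← Finset.mul_sum, walshDPi_zero, Finset.sum_const, Finset.card_univ, nsmul_eq_mul,
      mul_one]
    field_simp
    ring
  simp_rw [hS, norm_mul, mul_pow, norm_inv, RCLike.norm_natCast, integral_const_mul,
    integral_norm_sq_polySum hb ξ L c, inv_pow]

/-- The wavenumbers `𝐤 ∈ [0, b^L)ˢ ∖ {0}` regrouped by digit-length vector `𝓵 ∈ [0, L]ˢ ∖ {0}`:
`Σ_𝐤 F(𝓵(𝐤)) G(𝐤) = Σ_𝓵 F(𝓵) Σ_{𝐤 ∈ L_𝓵} G(𝐤)`. [folklore] -/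
private theorem sum_wavenumbers_eq_sum_lengthClass (hb : 1 < b) (L : ℕ) (F G : (ι → ℕ) → ℝ) :
    ∑ k ∈ (Fintype.piFinset fun _ : ι => range (b ^ L)).erase 0,
        F (fun i => digitLen b (k i)) * G k =
      ∑ ℓ ∈ (Fintype.piFinset fun _ : ι => range (L + 1)).erase 0,
        F ℓ * ∑ k ∈ lengthClass b ℓ, G k := by
  haveI : NeZero b := ⟨by omega⟩
  have hb0 : 0 < b := by omega
  have hmaps : ∀ k ∈ (Fintype.piFinset fun _ : ι => range (b ^ L)).erase 0,
      (fun i => digitLen b (k i)) ∈ (Fintype.piFinset fun _ : ι => range (L + 1)).erase 0 := by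
    intro k hk
    obtain ⟨hk0, hkL⟩ := Finset.mem_erase.1 hk
    refine Finset.mem_erase.2 ⟨fun h => hk0 (funext fun i => ?_), Fintype.mem_piFinset.2 fun i =>
      mem_range.2 (Nat.lt_succ_of_le (digitLen_le_of_lt_pow
        (mem_range.1 (Fintype.mem_piFinset.1 hkL i))))⟩
    exact digitLen_eq_zero_iff.1 (congrFun h i)
  have hfib : ∀ ℓ ∈ (Fintype.piFinset fun _ : ι => range (L + 1)).erase 0,
      ((Fintype.piFinset fun _ : ι => range (b ^ L)).erase 0).filter
          (fun k => (fun i => digitLen b (k i)) = ℓ) = lengthClass b ℓ := by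
    intro ℓ hℓ
    obtain ⟨hℓ0, hℓL⟩ := Finset.mem_erase.1 hℓ
    ext k
    simp only [Finset.mem_filter, Finset.mem_erase, Fintype.mem_piFinset, mem_range, lengthClass]
    constructor
    · rintro ⟨-, hlen⟩ i
      have hlen' : ∀ i, digitLen b (k i) = ℓ i := fun i => congrFun hlen i
      rw [← hlen' i]
      exact mem_digitBlock_digitLen hb (k i)
    · intro hk
      have hlen : ∀ i, digitLen b (k i) = ℓ i := fun i => digitLen_eq_of_mem_digitBlock hb (hk i)
      refine ⟨⟨fun hk0 => hℓ0 (funext fun i => ?_), fun i => ?_⟩, funext hlen⟩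
      · rw [← hlen i, hk0]
        simp [digitLen]
      · exact (lt_pow_of_mem_digitBlock (hk i)).trans_le (Nat.pow_le_pow_right hb0
          (Nat.le_of_lt_succ (mem_range.1 (Fintype.mem_piFinset.1 hℓL i))))
  rw [← Finset.sum_fiberwise_of_maps_to hmaps]
  refine Finset.sum_congr rfl fun ℓ hℓ => ?_
  rw [← hfib ℓ hℓ, Finset.mul_sum]
  exact Finset.sum_congr rfl fun k hk => by rw [(Finset.mem_filter.1 hk).2]

/-- **Theorem 13.6** [cite: DickPillichshammer2010, Thm. 13.6] (variance of the estimator `Î(f)`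
based on a scrambled point set), on the digit space and for a Walsh polynomial
`f = Σ_{𝐤 ∈ [0,b^L)ˢ} c_𝐤 wal_𝐤`: let `x_0, …, x_{N-1} ∈ [0,1)ˢ` be ANY points, randomised by
Owen's scrambling applied independently to each coordinate (with the same scramble for all points
in a given coordinate); then
`Var[Î(f)] = E|Î(f) - f̂(0)|² = Σ_{𝓵 ≠ 0} G_𝓵 σ_𝓵²(f)`,
`G_𝓵 = N⁻² Σ_{n,n'} ∏_i (b χ[⌊b^{ℓ_i} x_{n,i}⌋ = ⌊b^{ℓ_i} x_{n',i}⌋]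
  - χ[⌊b^{ℓ_i-1} x_{n,i}⌋ = ⌊b^{ℓ_i-1} x_{n',i}⌋])/(b-1)`,
`σ_𝓵²(f) = Σ_{𝐤 ∈ L_𝓵} |c_𝐤|²` (here `N² G_𝓵 = gainFactorPi b 𝓵 ξ`; the sum over
`𝓵 ∈ [0,L]ˢ ∖ {0}`, all other `σ_𝓵²` vanishing for such `f`; the book has `b` prime and
`f ∈ L_2([0,1]ˢ)` — the passage to `L_2` is Parseval's identity, not formalised here, and `b ≥ 2`
arbitrary suffices for this statement). -/
theorem integral_norm_sq_scrambledAveragePi_sub_eq_sum [NeZero b] (hb : 1 < b) [Nonempty κ]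
    (ξ : κ → ι → ℕ → Fin b) (L : ℕ) (c : (ι → ℕ) → ℂ) :
    ∫ π, ‖scrambledAveragePi b π ξ (walshPolyPi b L c) - c 0‖ ^ 2 ∂scrambleMeasurePi b ι =
      ((Fintype.card κ : ℝ) ^ 2)⁻¹ *
        ∑ ℓ ∈ (Fintype.piFinset fun _ : ι => range (L + 1)).erase 0,
          gainFactorPi b ℓ ξ * blockVariancePi b c ℓ := by
  rw [integral_norm_sq_scrambledAveragePi_sub hb ξ L c,
    sum_wavenumbers_eq_sum_lengthClass hb L (fun ℓ => gainFactorPi b ℓ ξ) fun k => ‖c k‖ ^ 2]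
  rfl

/-- The total variance of a Walsh polynomial splits over the digit-length classes:
`Σ_{𝐤 ≠ 0} |c_𝐤|² = Σ_{𝓵 ≠ 0} σ_𝓵²` [cite: DickPillichshammer2010, Thm. 13.6] (§13.3.2,
"`σ²(f) = Σ_𝓵 σ_𝓵²(f)`", p. 407; here for Walsh polynomials of degree `< b^L` per coordinate). -/
theorem sum_norm_sq_eq_sum_blockVariancePi (hb : 1 < b) (L : ℕ) (c : (ι → ℕ) → ℂ) :
    ∑ k ∈ (Fintype.piFinset fun _ : ι => range (b ^ L)).erase 0, ‖c k‖ ^ 2 =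
      ∑ ℓ ∈ (Fintype.piFinset fun _ : ι => range (L + 1)).erase 0, blockVariancePi b c ℓ := by
  have h := sum_wavenumbers_eq_sum_lengthClass hb L (fun _ => (1 : ℝ)) fun k => ‖c k‖ ^ 2
  simp only [one_mul] at h
  exact h

end Family

/-! ### The subset expansion of the gain coefficients ([Owen1998], eq. (5)) -/

section Expansion

variable {ι : Type*} [Fintype ι] {κ : Type*} [Fintype κ]

/-- Off the support, `ℓ_i = 0`. [folklore] -/
private theorem eq_zero_of_not_mem_lenSupport {ℓ : ι → ℕ} {i : ι} (hi : i ∉ lenSupport ℓ) :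
    ℓ i = 0 := by
  simpa [lenSupport] using hi

/-- The support of a nonzero digit-length vector is nonempty. [folklore] -/
private theorem lenSupport_nonempty {ℓ : ι → ℕ} (hℓ : ℓ ≠ 0) : (lenSupport ℓ).Nonempty := by
  obtain ⟨i, hi⟩ := Function.ne_iff.1 hℓ
  exact ⟨i, by simpa [lenSupport] using hi⟩

/-- `Σ_{n,n'} ∏_i χ[first d_i digits agree] = M_𝐝`. [folklore] -/
private theorem sum_sum_prod_prefixInd (d : ι → ℕ) (ξ : κ → ι → ℕ → Fin b) :
    ∑ n, ∑ n', ∏ i, (prefixInd b (d i) (ξ n i) (ξ n' i) : ℝ) = boxPairCount b d ξ := by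
  have h : ∀ n n', ∏ i, (prefixInd b (d i) (ξ n i) (ξ n' i) : ℝ) =
      if ∀ i, digitsPrefix b (d i) (ξ n i) = digitsPrefix b (d i) (ξ n' i) then 1 else 0 := by
    intro n n'
    simp only [prefixInd, Nat.cast_ite, Nat.cast_one, Nat.cast_zero, Fintype.prod_boole]
  simp_rw [h, boxPairCount, Finset.natCast_card_filter]
  rw [Fintype.sum_prod_type' (fun n n' : κ =>
    if ∀ i, digitsPrefix b (d i) (ξ n i) = digitsPrefix b (d i) (ξ n' i) then (1 : ℝ) else 0)]

variable [DecidableEq ι]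

/-- The product of the coordinate pair gains, multiplied out over the subsets of the support:
`∏_i (b χ_{ℓ_i} - χ_{ℓ_i-1})/(b-1) = (b-1)^{-|u|} Σ_{v ⊆ u} (-1)^{|u-v|} b^{|v|} ∏_i χ_{d^v_i}`
with `d^v = refineShape ℓ v` [cite: Owen1998, eq. (5)] (proof of Lemma 2). -/
private theorem prod_pairGain_eq_sum (hb : 1 < b) (ℓ : ι → ℕ) (η η' : ι → ℕ → Fin b) :
    ∏ i, pairGain b (ℓ i) (η i) (η' i) =
      (∑ v ∈ (lenSupport ℓ).powerset, (-1 : ℝ) ^ (lenSupport ℓ \ v).card * (b : ℝ) ^ v.card *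
          ∏ i, (prefixInd b (refineShape ℓ v i) (η i) (η' i) : ℝ)) /
        ((b : ℝ) - 1) ^ (lenSupport ℓ).card := by
  -- off the support all factors are `1`
  have hoff : ∀ v ∈ (lenSupport ℓ).powerset,
      ∏ i, (prefixInd b (refineShape ℓ v i) (η i) (η' i) : ℝ) =
        ∏ i ∈ lenSupport ℓ, (prefixInd b (refineShape ℓ v i) (η i) (η' i) : ℝ) := fun v hv =>
    (Finset.prod_subset (Finset.subset_univ (lenSupport ℓ)) fun i _ hi => by
      have hiv : i ∉ v := fun h => hi (Finset.mem_powerset.1 hv h)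
      simp only [refineShape, if_neg hiv]
      rw [eq_zero_of_not_mem_lenSupport hi, Nat.zero_sub, prefixInd_zero, Nat.cast_one]).symm
  rw [← Finset.prod_subset (Finset.subset_univ (lenSupport ℓ)) fun i _ hi => by
    rw [eq_zero_of_not_mem_lenSupport hi, pairGain_zero hb]]
  simp only [pairGain]
  rw [Finset.prod_div_distrib, Finset.prod_const]
  congr 1
  simp_rw [sub_eq_add_neg]
  rw [Finset.prod_add]
  refine Finset.sum_congr rfl fun v hv => ?_
  have hvU : v ⊆ lenSupport ℓ := Finset.mem_powerset.1 hv
  have h1 : ∏ i ∈ lenSupport ℓ \ v, (prefixInd b (refineShape ℓ v i) (η i) (η' i) : ℝ) =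
      ∏ i ∈ lenSupport ℓ \ v, (prefixInd b (ℓ i - 1) (η i) (η' i) : ℝ) :=
    Finset.prod_congr rfl fun i hi => by simp [refineShape, (Finset.mem_sdiff.1 hi).2]
  have h2 : ∏ i ∈ v, (prefixInd b (refineShape ℓ v i) (η i) (η' i) : ℝ) =
      ∏ i ∈ v, (prefixInd b (ℓ i) (η i) (η' i) : ℝ) :=
    Finset.prod_congr rfl fun i hi => by simp [refineShape, hi]
  rw [hoff v hv, ← Finset.prod_sdiff hvU, h1, h2, Finset.prod_mul_distrib, Finset.prod_const,
    Finset.prod_neg]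
  ring

/-- **Subset expansion of the gain coefficients** [cite: Owen1998, eq. (5)] (with eq. (1), (3);
the book, [cite: DickPillichshammer2010, Thm. 13.6], leaves `G_𝓵` as the product of differences):
with `u = {i : ℓ_i ≥ 1}` and, for `v ⊆ u`, `M_{d^v}` the number of ordered pairs of points sharing
`ℓ_i` digits in the coordinates `i ∈ v` and `ℓ_i - 1` digits in the coordinates `i ∈ u ∖ v`,
`N² G_𝓵 = (b-1)^{-|u|} Σ_{v ⊆ u} (-1)^{|u ∖ v|} b^{|v|} M_{d^v}` (Owen:
`Γ_{u,κ} = n⁻¹ (b-1)^{-|u|} Σ_{v ⊆ u} (-1)^{|u-v|} b^{|v|} Σ_{i,i'} ∏_r N^{[r∈v]} W^{[r∉v]}`). -/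
theorem gainFactorPi_eq_sum_boxPairCount (hb : 1 < b) (ℓ : ι → ℕ) (ξ : κ → ι → ℕ → Fin b) :
    gainFactorPi b ℓ ξ =
      (∑ v ∈ (lenSupport ℓ).powerset, (-1 : ℝ) ^ (lenSupport ℓ \ v).card * (b : ℝ) ^ v.card *
          (boxPairCount b (refineShape ℓ v) ξ : ℝ)) / ((b : ℝ) - 1) ^ (lenSupport ℓ).card := by
  rw [gainFactorPi]
  simp_rw [prod_pairGain_eq_sum hb ℓ, ← Finset.sum_div]
  congr 1
  simp_rw [← sum_sum_prod_prefixInd _ ξ, Finset.mul_sum]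
  conv_rhs => rw [Finset.sum_comm]
  refine Finset.sum_congr rfl fun n _ => ?_
  rw [Finset.sum_comm]

/-- The order of a refined shape: `|d^v|_1 + |u ∖ v| = |𝓵|_1` (any `v`; for `i ∉ u`,
`ℓ_i - 1 = 0 = ℓ_i` in `ℕ`). [folklore] -/
private theorem sum_refineShape_add (ℓ : ι → ℕ) (v : Finset ι) :
    ∑ i, refineShape ℓ v i + (lenSupport ℓ \ v).card = ∑ i, ℓ i := by
  have key : ∀ i, ℓ i = refineShape ℓ v i + if i ∈ lenSupport ℓ \ v then 1 else 0 := by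
    intro i
    simp only [refineShape, Finset.mem_sdiff, lenSupport, Finset.mem_filter, Finset.mem_univ,
      true_and]
    by_cases hi : i ∈ v
    · simp [hi]
    · by_cases h0 : ℓ i = 0
      · simp [hi, h0]
      · simp [hi, h0]; omega
  conv_rhs => rw [Finset.sum_congr rfl fun i _ => key i]
  rw [Finset.sum_add_distrib, Finset.sum_boole, Finset.filter_univ_mem, Nat.cast_id]

omit [Fintype ι] in
/-- `Σ_{v ⊆ u} (-1)^{|u ∖ v|} = 0` for `u ≠ ∅`. [cite: Owen1998, eq. (8)] -/
private theorem sum_powerset_neg_one_pow_card_sdiff {U : Finset ι} (hU : U.Nonempty) :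
    ∑ v ∈ U.powerset, (-1 : ℝ) ^ (U \ v).card = 0 := by
  have h : ∀ v ∈ U.powerset, (-1 : ℝ) ^ (U \ v).card = (-1) ^ U.card * (-1) ^ v.card := by
    intro v hv
    have hc := Finset.card_sdiff_add_card_eq_card (Finset.mem_powerset.1 hv)
    calc (-1 : ℝ) ^ (U \ v).card
        = (-1) ^ (U \ v).card * ((-1) ^ v.card * (-1) ^ v.card) := by
          rw [← mul_pow, neg_one_mul, neg_neg, one_pow, mul_one]
      _ = (-1) ^ U.card * (-1) ^ v.card := by rw [← mul_assoc, ← pow_add, hc]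
  rw [Finset.sum_congr rfl h, ← Finset.mul_sum]
  have h0 : ∑ v ∈ U.powerset, (-1 : ℝ) ^ v.card = 0 := by
    exact_mod_cast Finset.sum_powerset_neg_one_pow_card_of_nonempty hU
  rw [h0, mul_zero]

end Expansion

/-! ### Scrambled `(t, m, s)`-nets: Owen's Lemma 2 and the bound `Γ ≤ b^t ((b+1)/(b-1))^s` -/

/-- Appending one digit to a prefix comparison: two sequences share `w + 1` digits iff they share
`w` digits and digit `w`. [folklore] -/
private theorem digitsPrefix_succ_eq_iff {w : ℕ} (ζ θ : ℕ → Fin b) :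
    digitsPrefix b (w + 1) ζ = digitsPrefix b (w + 1) θ ↔
      digitsPrefix b w ζ = digitsPrefix b w θ ∧ ζ w = θ w := by
  constructor
  · intro h
    exact ⟨funext fun i => by simpa [digitsPrefix] using congrFun h (Fin.castSucc i),
      by simpa [digitsPrefix] using congrFun h (Fin.last w)⟩
  · rintro ⟨h1, h2⟩
    funext i
    refine Fin.lastCases ?_ (fun j => ?_) i
    · simpa [digitsPrefix] using h2
    · simpa [digitsPrefix] using congrFun h1 j

/-- Sharing `w` digits implies sharing `w' ≤ w` digits. [folklore] -/
private theorem digitsPrefix_eq_of_le {w w' : ℕ} (h : w' ≤ w) {ζ θ : ℕ → Fin b}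
    (he : digitsPrefix b w ζ = digitsPrefix b w θ) :
    digitsPrefix b w' ζ = digitsPrefix b w' θ :=
  funext fun i => by simpa [digitsPrefix] using congrFun he (Fin.castLE h i)

/-- Changing a sequence at position `w` or later does not change its first `w` digits.
[folklore] -/
private theorem digitsPrefix_update_of_le {w j : ℕ} (h : w ≤ j) (ζ : ℕ → Fin b) (e : Fin b) :
    digitsPrefix b w (Function.update ζ j e) = digitsPrefix b w ζ :=
  funext fun i => by
    simp [digitsPrefix, Function.update_of_ne (Nat.ne_of_lt (lt_of_lt_of_le i.2 h))]

section Nets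

variable {ι : Type*} [Fintype ι] {κ : Type*} [Fintype κ]

/-- `M_𝐝 = Σ_n #{n' : x_{n'} in the box of shape 𝐝 around x_n}`. [folklore] -/
private theorem boxPairCount_eq_sum (d : ι → ℕ) (ξ : κ → ι → ℕ → Fin b) :
    boxPairCount b d ξ = ∑ n, (univ.filter fun n' =>
      ∀ i, digitsPrefix b (d i) (ξ n' i) = digitsPrefix b (d i) (ξ n i)).card := by
  simp only [boxPairCount, card_filter]
  rw [Fintype.sum_prod_type' (fun n n' : κ =>
    if ∀ i, digitsPrefix b (d i) (ξ n i) = digitsPrefix b (d i) (ξ n' i) then 1 else 0)]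
  exact sum_congr rfl fun n _ => sum_congr rfl fun n' _ =>
    if_congr (forall_congr' fun i => eq_comm) rfl rfl

/-- The diagonal pairs: `N ≤ M_𝐝`. [folklore] -/
private theorem card_le_boxPairCount (d : ι → ℕ) (ξ : κ → ι → ℕ → Fin b) :
    Fintype.card κ ≤ boxPairCount b d ξ := by
  unfold boxPairCount
  rw [← card_univ]
  exact card_le_card_of_injOn (fun n => (n, n)) (fun n _ => by simp)
    (fun n₁ _ n₂ _ hn => congrArg Prod.fst hn)

/-- A net has at least one point. [folklore] -/
private theorem IsDigitNetPi.nonempty {t m : ℕ} {ξ : κ → ι → ℕ → Fin b} [NeZero b]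
    (h : IsDigitNetPi b t m ξ) : Nonempty κ :=
  Fintype.card_pos_iff.1 (h.2.1 ▸ Nat.pow_pos (Nat.pos_of_ne_zero (NeZero.ne b)))

variable [DecidableEq ι]

/-- The points in a box of shape `𝐝` (around the representative `η`) split according to their
digit `d_{i₀}` in coordinate `i₀`, into the `b` sub-boxes refined once in that coordinate.
[folklore] -/
private theorem card_box_eq_sum_digit (ξ : κ → ι → ℕ → Fin b) (d : ι → ℕ) (η : ι → ℕ → Fin b)
    (i₀ : ι) :
    (univ.filter fun n => ∀ i, digitsPrefix b (d i) (ξ n i) = digitsPrefix b (d i) (η i)).card =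
      ∑ e : Fin b, (univ.filter fun n => ∀ i,
        digitsPrefix b (Function.update d i₀ (d i₀ + 1) i) (ξ n i) =
          digitsPrefix b (Function.update d i₀ (d i₀ + 1) i)
            (Function.update η i₀ (Function.update (η i₀) (d i₀) e) i)).card := by
  rw [card_eq_sum_card_fiberwise (f := fun n => ξ n i₀ (d i₀)) (t := univ) fun _ _ =>
    mem_coe.2 (mem_univ _)]
  refine sum_congr rfl fun e _ => ?_
  rw [filter_filter]
  refine congrArg _ (filter_congr fun n _ => ?_)
  have hsplit : ∀ i, (digitsPrefix b (Function.update d i₀ (d i₀ + 1) i) (ξ n i) =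
      digitsPrefix b (Function.update d i₀ (d i₀ + 1) i)
        (Function.update η i₀ (Function.update (η i₀) (d i₀) e) i)) ↔
      (digitsPrefix b (d i) (ξ n i) = digitsPrefix b (d i) (η i) ∧
        (i = i₀ → ξ n i₀ (d i₀) = e)) := by
    intro i
    by_cases hi : i = i₀
    · subst hi
      rw [Function.update_self, Function.update_self, digitsPrefix_succ_eq_iff,
        digitsPrefix_update_of_le le_rfl, Function.update_self]
      simp
    · rw [Function.update_of_ne hi, Function.update_of_ne hi]
      simp [hi]
  simp_rw [hsplit, forall_and]
  simp

/-- A `(t, m, s)`-net is fair at every order `≤ m - t`: a box of shape `𝐝` with `|𝐝|_1 ≤ m - t`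
(volume `b^{-|𝐝|_1} ≥ b^{t-m}`) contains exactly `b^{m - |𝐝|_1}` of the `b^m` points
[cite: DickPillichshammer2010, Remark 4.9] ((2): every elementary box of larger volume is a disjoint
union of elementary boxes of volume `b^{t-m}`, so a `(t, m, s)`-net is a `(t+1, m, s)`-net). -/
theorem IsDigitNetPi.card_filter_box_eq {t m : ℕ} {ξ : κ → ι → ℕ → Fin b}
    (h : IsDigitNetPi b t m ξ) {d : ι → ℕ} (hd : ∑ i, d i ≤ m - t) (η : ι → ℕ → Fin b) :
    (univ.filter fun n => ∀ i, digitsPrefix b (d i) (ξ n i) = digitsPrefix b (d i) (η i)).card =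
      b ^ (m - ∑ i, d i) := by
  obtain ⟨htm, hcard, hfair⟩ := h
  obtain ⟨j, hj⟩ : ∃ j, ∑ i, d i + j = m - t := ⟨m - t - ∑ i, d i, by omega⟩
  induction j generalizing d η with
  | zero =>
    rw [hfair d (by omega) fun i => digitsPrefix b (d i) (η i)]
    congr 1
    omega
  | succ j ih =>
    rcases isEmpty_or_nonempty ι with hι | hι
    · have h0 : ∑ i, d i = 0 := by simp [Finset.univ_eq_empty]
      rw [h0, Nat.sub_zero, ← hcard, ← Finset.card_univ]
      exact congrArg _ (Finset.filter_true_of_mem fun n _ i => isEmptyElim i)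
    · obtain ⟨i₀⟩ := hι
      have hd' : ∑ i, Function.update d i₀ (d i₀ + 1) i = ∑ i, d i + 1 := by
        rw [Finset.sum_update_of_mem (mem_univ i₀),
          Finset.sum_eq_add_sum_sdiff_singleton_of_mem (mem_univ i₀) d]
        ring
      rw [card_box_eq_sum_digit ξ d η i₀, sum_congr rfl fun e _ =>
          ih (d := Function.update d i₀ (d i₀ + 1)) (by rw [hd']; omega) _ (by rw [hd']; omega),
        sum_const, card_univ, Fintype.card_fin, smul_eq_mul, hd',
        (by omega : m - ∑ i, d i = (m - (∑ i, d i + 1)) + 1), pow_succ']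

/-- For a `(t, m, s)`-net, `M_𝐝 = b^m · b^{m - |𝐝|_1}` for every shape with `|𝐝|_1 ≤ m - t`
[cite: DickPillichshammer2010, Remark 4.9] (with Def. 4.7); [cite: Owen1998, Lemma 2] (proof:
"each of the `n = b^m` points is in such a box and each box has `b^{m - |κ| - |u|}` points"). -/
theorem IsDigitNetPi.boxPairCount_eq {t m : ℕ} {ξ : κ → ι → ℕ → Fin b} (h : IsDigitNetPi b t m ξ)
    {d : ι → ℕ} (hd : ∑ i, d i ≤ m - t) :
    boxPairCount b d ξ = b ^ m * b ^ (m - ∑ i, d i) := by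
  rw [boxPairCount_eq_sum, sum_congr rfl fun n _ => h.card_filter_box_eq hd (ξ n), sum_const,
    card_univ, h.2.1, smul_eq_mul]

/-- Every shape of order `≥ K` can be coarsened to a shape of order exactly `K`. [folklore] -/
private theorem exists_le_sum_eq {d : ι → ℕ} {K : ℕ} (hK : K ≤ ∑ i, d i) :
    ∃ d' : ι → ℕ, (∀ i, d' i ≤ d i) ∧ ∑ i, d' i = K := by
  obtain ⟨s, hs⟩ : ∃ s, ∑ i, d i = K + s := ⟨∑ i, d i - K, by omega⟩
  induction s generalizing d with
  | zero => exact ⟨d, fun _ => le_rfl, by omega⟩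
  | succ s ih =>
    obtain ⟨i₀, -, hi₀⟩ := Finset.exists_ne_zero_of_sum_ne_zero (by omega : ∑ i, d i ≠ 0)
    have hsum : ∑ i, Function.update d i₀ (d i₀ - 1) i = K + s := by
      have := Finset.sum_eq_add_sum_sdiff_singleton_of_mem (mem_univ i₀) d
      rw [Finset.sum_update_of_mem (mem_univ i₀)]
      omega
    obtain ⟨d', hd', hK'⟩ := ih (by omega) hsum
    refine ⟨d', fun i => (hd' i).trans ?_, hK'⟩
    rw [Function.update_apply]
    split_ifs with hi
    · subst hi; exact Nat.sub_le _ _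
    · exact le_rfl

/-- For a `(t, m, s)`-net, a box of shape `𝐝` with `|𝐝|_1 ≥ m - t` contains at most `b^t` points
(it lies in an elementary box of volume `b^{t-m}`). [cite: DickPillichshammer2010, Def. 4.7] -/
theorem IsDigitNetPi.card_filter_box_le {t m : ℕ} {ξ : κ → ι → ℕ → Fin b}
    (h : IsDigitNetPi b t m ξ) {d : ι → ℕ} (hd : m - t ≤ ∑ i, d i) (η : ι → ℕ → Fin b) :
    (univ.filter fun n => ∀ i, digitsPrefix b (d i) (ξ n i) = digitsPrefix b (d i) (η i)).card ≤
      b ^ t := by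
  obtain ⟨d', hd', hK⟩ := exists_le_sum_eq hd
  calc (univ.filter fun n => ∀ i, digitsPrefix b (d i) (ξ n i) = digitsPrefix b (d i) (η i)).card
      ≤ (univ.filter fun n =>
          ∀ i, digitsPrefix b (d' i) (ξ n i) = digitsPrefix b (d' i) (η i)).card :=
        card_le_card fun n hn => by
          simp only [mem_filter, mem_univ, true_and] at hn ⊢
          exact fun i => digitsPrefix_eq_of_le (hd' i) (hn i)
    _ = b ^ t := by
        rw [h.card_filter_box_eq hK.le η, hK, (by have := h.1; omega : m - (m - t) = t)]

/-- For a `(t, m, s)`-net, `M_𝐝 ≤ b^m · b^t` for every shape with `|𝐝|_1 ≥ m - t` (and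
`M_𝐝 ≥ b^m` always) [cite: Owen1998, Lemma 4] (eq. (10): `|M_v| < n b^t`);
[cite: DickPillichshammer2010, Def. 4.7]. -/
theorem IsDigitNetPi.boxPairCount_le {t m : ℕ} {ξ : κ → ι → ℕ → Fin b} (h : IsDigitNetPi b t m ξ)
    {d : ι → ℕ} (hd : m - t ≤ ∑ i, d i) : boxPairCount b d ξ ≤ b ^ m * b ^ t := by
  rw [boxPairCount_eq_sum]
  calc ∑ n, (univ.filter fun n' =>
        ∀ i, digitsPrefix b (d i) (ξ n' i) = digitsPrefix b (d i) (ξ n i)).card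
      ≤ ∑ _n : κ, b ^ t := sum_le_sum fun n _ => h.card_filter_box_le hd (ξ n)
    _ = b ^ m * b ^ t := by rw [sum_const, card_univ, h.2.1, smul_eq_mul]

/-- **Owen's Lemma 2** [cite: Owen1998, Lemma 2] (quoted with
[cite: DickPillichshammer2010, Thm. 13.6] in the remark after Theorem 13.9, p. 411: "the gain
coefficients `Γ_𝓵` are `0` for all `𝓵 ∈ ℕ_0^s ∖ {0}` with `|𝓵|_1 ≤ m - t`"): for a `(t, m, s)`-net
in base `b` and a digit-length vector `𝓵 ≠ 0` with `|𝓵|_1 ≤ m - t` (Owen: `0 < |u|`,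
`|κ| + |u| ≤ m - t`), `G_𝓵 = 0` — all the refined boxes are fair, and
`Σ_{v ⊆ u} (-1)^{|u-v|} = 0`. -/
theorem IsDigitNetPi.gainFactorPi_eq_zero (hb : 1 < b) {t m : ℕ} {ξ : κ → ι → ℕ → Fin b}
    (h : IsDigitNetPi b t m ξ) {ℓ : ι → ℕ} (hℓ0 : ℓ ≠ 0) (hℓ : ∑ i, ℓ i ≤ m - t) :
    gainFactorPi b ℓ ξ = 0 := by
  rw [gainFactorPi_eq_sum_boxPairCount hb, div_eq_zero_iff]
  left
  have hterm : ∀ v ∈ (lenSupport ℓ).powerset,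
      (-1 : ℝ) ^ (lenSupport ℓ \ v).card * (b : ℝ) ^ v.card *
          (boxPairCount b (refineShape ℓ v) ξ : ℝ) =
        (-1 : ℝ) ^ (lenSupport ℓ \ v).card *
          ((b : ℝ) ^ m * (b : ℝ) ^ (m - ∑ i, ℓ i) * (b : ℝ) ^ (lenSupport ℓ).card) := by
    intro v hv
    have hv' := Finset.mem_powerset.1 hv
    have hsum := sum_refineShape_add ℓ v
    have hcard := Finset.card_sdiff_add_card_eq_card hv'
    rw [h.boxPairCount_eq (by omega : ∑ i, refineShape ℓ v i ≤ m - t)]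
    push_cast
    rw [(by omega : m - ∑ i, refineShape ℓ v i = (m - ∑ i, ℓ i) + (lenSupport ℓ \ v).card),
      ← hcard]
    ring
  rw [Finset.sum_congr rfl hterm, ← Finset.sum_mul,
    sum_powerset_neg_one_pow_card_sdiff (lenSupport_nonempty hℓ0), zero_mul]

/-- **Owen's bound on the gain coefficients** [cite: Owen1998, Thm. 1] (eq. (12), via Lemma 4,
eq. (9)–(10); quoted with [cite: DickPillichshammer2010, Thm. 13.6] in the remark after
Theorem 13.9, p. 411, and as [cite: Lemieux2009, Prop. 6.4]): for a `(t, m, s)`-net in base `b`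
(`N = b^m` points) and `𝓵 ≠ 0` with support `u`,
`N² G_𝓵 ≤ b^m · b^t · ((b+1)/(b-1))^{|u|}`, i.e. `Γ_𝓵 = N G_𝓵 ≤ b^t ((b+1)/(b-1))^{|u|}`.
Proof: subtract from each `M_{d^v}` its fair value `b^{2m}/b^{|d^v|_1}` (their signed weighted sum
vanishes since `Σ_{v ⊆ u} (-1)^{|u-v|} = 0`); each deviation is at most `b^{m+t}` in absolute value,
and `Σ_{v ⊆ u} b^{|v|} = (b+1)^{|u|}`. -/
theorem IsDigitNetPi.gainFactorPi_le (hb : 1 < b) {t m : ℕ} {ξ : κ → ι → ℕ → Fin b}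
    (h : IsDigitNetPi b t m ξ) {ℓ : ι → ℕ} (hℓ0 : ℓ ≠ 0) :
    gainFactorPi b ℓ ξ ≤
      (b : ℝ) ^ m * (b : ℝ) ^ t * (((b : ℝ) + 1) / ((b : ℝ) - 1)) ^ (lenSupport ℓ).card := by
  have hb1 : (1 : ℝ) < b := by exact_mod_cast hb
  have hb0 : (b : ℝ) ≠ 0 := by exact_mod_cast (show b ≠ 0 by omega)
  have hD : (0 : ℝ) < ((b : ℝ) - 1) ^ (lenSupport ℓ).card := pow_pos (sub_pos.2 hb1) _
  have htm := h.1
  rw [gainFactorPi_eq_sum_boxPairCount hb, div_pow, mul_div_assoc']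
  refine div_le_div_of_nonneg_right ?_ hD.le
  -- the fair values `E v = b^{2m} / b^{|d^v|_1}`
  obtain ⟨E, hE⟩ : ∃ E : Finset ι → ℝ,
      ∀ v, E v = (b : ℝ) ^ m * (b : ℝ) ^ m / (b : ℝ) ^ (∑ i, refineShape ℓ v i) :=
    ⟨_, fun v => rfl⟩
  have hEv : ∀ v ∈ (lenSupport ℓ).powerset, (b : ℝ) ^ v.card * E v =
      (b : ℝ) ^ m * (b : ℝ) ^ m * (b : ℝ) ^ (lenSupport ℓ).card / (b : ℝ) ^ (∑ i, ℓ i) := by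
    intro v hv
    have hv' := Finset.mem_powerset.1 hv
    have hsum := sum_refineShape_add ℓ v
    have hcard := Finset.card_sdiff_add_card_eq_card hv'
    rw [hE, mul_div_assoc', div_eq_div_iff (pow_ne_zero _ hb0) (pow_ne_zero _ hb0), ← hsum,
      ← hcard]
    ring
  have hzero : ∑ v ∈ (lenSupport ℓ).powerset,
      (-1 : ℝ) ^ (lenSupport ℓ \ v).card * (b : ℝ) ^ v.card * E v = 0 := by
    calc ∑ v ∈ (lenSupport ℓ).powerset, (-1 : ℝ) ^ (lenSupport ℓ \ v).card * (b : ℝ) ^ v.card * E v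
        = ∑ v ∈ (lenSupport ℓ).powerset, (-1 : ℝ) ^ (lenSupport ℓ \ v).card *
            ((b : ℝ) ^ m * (b : ℝ) ^ m * (b : ℝ) ^ (lenSupport ℓ).card / (b : ℝ) ^ (∑ i, ℓ i)) :=
          Finset.sum_congr rfl fun v hv => by rw [mul_assoc, hEv v hv]
      _ = 0 := by
          rw [← Finset.sum_mul, sum_powerset_neg_one_pow_card_sdiff (lenSupport_nonempty hℓ0),
            zero_mul]
  -- the deviations from the fair values
  have hdev : ∀ v ∈ (lenSupport ℓ).powerset,
      |(boxPairCount b (refineShape ℓ v) ξ : ℝ) - E v| ≤ (b : ℝ) ^ m * (b : ℝ) ^ t := by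
    intro v hv
    by_cases hle : ∑ i, refineShape ℓ v i ≤ m - t
    · rw [h.boxPairCount_eq hle, hE]
      push_cast
      rw [pow_sub₀ _ hb0 (by omega : ∑ i, refineShape ℓ v i ≤ m), div_eq_mul_inv, mul_assoc,
        sub_self, abs_zero]
      positivity
    · rw [not_le] at hle
      have hP1 : (b : ℝ) ^ m ≤ boxPairCount b (refineShape ℓ v) ξ := by
        have := card_le_boxPairCount (b := b) (refineShape ℓ v) ξ
        rw [h.2.1] at this
        exact_mod_cast this
      have hP2 : (boxPairCount b (refineShape ℓ v) ξ : ℝ) ≤ (b : ℝ) ^ m * (b : ℝ) ^ t := by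
        exact_mod_cast h.boxPairCount_le hle.le
      have hE1 : 0 ≤ E v := by rw [hE]; positivity
      have hE2 : E v ≤ (b : ℝ) ^ m * (b : ℝ) ^ t := by
        rw [hE, div_le_iff₀ (by positivity), mul_assoc]
        refine mul_le_mul_of_nonneg_left ?_ (by positivity)
        rw [← pow_add]
        exact pow_le_pow_right₀ hb1.le (by omega)
      rw [abs_sub_le_iff]
      constructor <;> linarith
  -- `Σ_{v ⊆ u} b^{|v|} = (b+1)^{|u|}`
  have hbinom : ∑ v ∈ (lenSupport ℓ).powerset, (b : ℝ) ^ v.card =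
      ((b : ℝ) + 1) ^ (lenSupport ℓ).card := by
    have := Finset.sum_pow_mul_eq_add_pow (b : ℝ) 1 (lenSupport ℓ)
    simpa only [one_pow, mul_one] using this
  calc ∑ v ∈ (lenSupport ℓ).powerset, (-1 : ℝ) ^ (lenSupport ℓ \ v).card * (b : ℝ) ^ v.card *
          (boxPairCount b (refineShape ℓ v) ξ : ℝ)
      = ∑ v ∈ (lenSupport ℓ).powerset, (-1 : ℝ) ^ (lenSupport ℓ \ v).card * (b : ℝ) ^ v.card *
          ((boxPairCount b (refineShape ℓ v) ξ : ℝ) - E v) := by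
        rw [← sub_zero (∑ v ∈ (lenSupport ℓ).powerset, (-1 : ℝ) ^ (lenSupport ℓ \ v).card *
          (b : ℝ) ^ v.card * (boxPairCount b (refineShape ℓ v) ξ : ℝ)), ← hzero,
          ← Finset.sum_sub_distrib]
        exact Finset.sum_congr rfl fun v _ => by ring
    _ ≤ ∑ v ∈ (lenSupport ℓ).powerset, (b : ℝ) ^ v.card * ((b : ℝ) ^ m * (b : ℝ) ^ t) :=
        Finset.sum_le_sum fun v hv => by
          calc (-1 : ℝ) ^ (lenSupport ℓ \ v).card * (b : ℝ) ^ v.card *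
                ((boxPairCount b (refineShape ℓ v) ξ : ℝ) - E v)
              ≤ |(-1 : ℝ) ^ (lenSupport ℓ \ v).card * (b : ℝ) ^ v.card *
                  ((boxPairCount b (refineShape ℓ v) ξ : ℝ) - E v)| := le_abs_self _
            _ = (b : ℝ) ^ v.card * |(boxPairCount b (refineShape ℓ v) ξ : ℝ) - E v| := by
                rw [abs_mul, abs_mul, abs_pow, abs_neg, abs_one, one_pow, one_mul,
                  abs_of_nonneg (by positivity : (0 : ℝ) ≤ (b : ℝ) ^ v.card)]
            _ ≤ (b : ℝ) ^ v.card * ((b : ℝ) ^ m * (b : ℝ) ^ t) :=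
                mul_le_mul_of_nonneg_left (hdev v hv) (by positivity)
    _ = (b : ℝ) ^ m * (b : ℝ) ^ t * ((b : ℝ) + 1) ^ (lenSupport ℓ).card := by
        rw [← Finset.sum_mul, hbinom, mul_comm]

/-- The same bound with the dimension in the exponent and the number of points as a factor:
`N² G_𝓵 ≤ N b^t ((b+1)/(b-1))^s`, i.e. **`Γ_𝓵 ≤ b^t ((b+1)/(b-1))^s`** [cite: Owen1998, Thm. 1]
(eq. (12)); [cite: DickPillichshammer2010, Thm. 13.6] with the remark on p. 411;
[cite: Lemieux2009, Prop. 6.4]. -/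
theorem IsDigitNetPi.gainFactorPi_le_card_mul (hb : 1 < b) {t m : ℕ} {ξ : κ → ι → ℕ → Fin b}
    (h : IsDigitNetPi b t m ξ) {ℓ : ι → ℕ} (hℓ0 : ℓ ≠ 0) :
    gainFactorPi b ℓ ξ ≤
      (Fintype.card κ : ℝ) * (b : ℝ) ^ t * (((b : ℝ) + 1) / ((b : ℝ) - 1)) ^ Fintype.card ι := by
  have hb1 : (1 : ℝ) < b := by exact_mod_cast hb
  have hR : (1 : ℝ) ≤ ((b : ℝ) + 1) / ((b : ℝ) - 1) :=
    (one_le_div (sub_pos.2 hb1)).2 (by linarith)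
  refine (h.gainFactorPi_le hb hℓ0).trans ?_
  rw [h.2.1]
  push_cast
  exact mul_le_mul_of_nonneg_left (pow_le_pow_right₀ hR (Finset.card_le_univ _)) (by positivity)

/-- **Variance of a scrambled `(t, m, s)`-net, exact form**
[cite: DickPillichshammer2010, Thm. 13.6] with Owen's Lemma 2 (the remark after Theorem 13.9,
p. 411); [cite: Owen1998, Thm. 1] (proof: "use Lemma 2"): only the digit-length vectors with
`|𝓵|_1 > m - t` contribute,
`E|Î(f) - c_0|² = Σ_{𝓵 ≠ 0, |𝓵|_1 > m-t} G_𝓵 σ_𝓵²(f)` (Walsh polynomial of degree `< b^L` per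
coordinate, so `𝓵 ∈ [0,L]ˢ`). -/
theorem IsDigitNetPi.integral_norm_sq_scrambledAveragePi_sub_eq [NeZero b] (hb : 1 < b) {t m : ℕ}
    {ξ : κ → ι → ℕ → Fin b} (h : IsDigitNetPi b t m ξ) (L : ℕ) (c : (ι → ℕ) → ℂ) :
    ∫ π, ‖scrambledAveragePi b π ξ (walshPolyPi b L c) - c 0‖ ^ 2 ∂scrambleMeasurePi b ι =
      ((Fintype.card κ : ℝ) ^ 2)⁻¹ *
        ∑ ℓ ∈ ((Fintype.piFinset fun _ : ι => range (L + 1)).erase 0).filter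
            (fun ℓ => m - t < ∑ i, ℓ i),
          gainFactorPi b ℓ ξ * blockVariancePi b c ℓ := by
  haveI := h.nonempty
  rw [integral_norm_sq_scrambledAveragePi_sub_eq_sum hb ξ L c, Finset.sum_filter]
  congr 1
  refine sum_congr rfl fun ℓ hℓ => ?_
  split_ifs with hlt
  · rfl
  · rw [h.gainFactorPi_eq_zero hb (Finset.mem_erase.1 hℓ).1 (not_lt.1 hlt), zero_mul]

/-- **Variance bound for a scrambled `(t, m, s)`-net** [cite: Owen1998, Thm. 1] (eq. (12):
`V(Î) ≤ b^t ((b+1)/(b-1))^s σ²/n`); [cite: Lemieux2009, Prop. 6.4];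
[cite: DickPillichshammer2010, Thm. 13.6] with the bound `Γ_𝓵 ≤ b^t ((b+1)/(b-1))^s` (p. 411):
for a Walsh polynomial `f` of degree `< b^L` per coordinate on the digit space,
`σ²(f) = Σ_{𝐤 ≠ 0} |c_𝐤|²`, and a `(t, m, s)`-net in base `b` (`N = b^m` points) scrambled
coordinate-wise by independent nested uniform scrambles,
`E|Î(f) - c_0|² ≤ (b^t/N) ((b+1)/(b-1))^s σ²(f)`. -/
theorem IsDigitNetPi.integral_norm_sq_scrambledAveragePi_sub_le [NeZero b] (hb : 1 < b) {t m : ℕ}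
    {ξ : κ → ι → ℕ → Fin b} (h : IsDigitNetPi b t m ξ) (L : ℕ) (c : (ι → ℕ) → ℂ) :
    ∫ π, ‖scrambledAveragePi b π ξ (walshPolyPi b L c) - c 0‖ ^ 2 ∂scrambleMeasurePi b ι ≤
      (b : ℝ) ^ t / (b : ℝ) ^ m * (((b : ℝ) + 1) / ((b : ℝ) - 1)) ^ Fintype.card ι *
        ∑ k ∈ (Fintype.piFinset fun _ : ι => range (b ^ L)).erase 0, ‖c k‖ ^ 2 := by
  haveI := h.nonempty
  have hB : (b : ℝ) ^ m ≠ 0 := pow_ne_zero _ (by exact_mod_cast (NeZero.ne b))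
  have hlen : ∀ k ∈ (Fintype.piFinset fun _ : ι => range (b ^ L)).erase 0,
      (fun i => digitLen b (k i)) ≠ 0 := by
    intro k hk h0
    exact (Finset.mem_erase.1 hk).1 (funext fun i => digitLen_eq_zero_iff.1 (congrFun h0 i))
  rw [integral_norm_sq_scrambledAveragePi_sub hb ξ L c, h.2.1]
  push_cast
  calc (((b : ℝ) ^ m) ^ 2)⁻¹ * ∑ k ∈ (Fintype.piFinset fun _ : ι => range (b ^ L)).erase 0,
          gainFactorPi b (fun i => digitLen b (k i)) ξ * ‖c k‖ ^ 2
      ≤ (((b : ℝ) ^ m) ^ 2)⁻¹ * ∑ k ∈ (Fintype.piFinset fun _ : ι => range (b ^ L)).erase 0,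
          ((b : ℝ) ^ m * (b : ℝ) ^ t * (((b : ℝ) + 1) / ((b : ℝ) - 1)) ^ Fintype.card ι) *
            ‖c k‖ ^ 2 := by
        refine mul_le_mul_of_nonneg_left (sum_le_sum fun k hk =>
          mul_le_mul_of_nonneg_right ?_ (sq_nonneg _)) (by positivity)
        have := h.gainFactorPi_le_card_mul hb (hlen k hk)
        rw [h.2.1] at this
        push_cast at this
        exact this
    _ = (b : ℝ) ^ t / (b : ℝ) ^ m * (((b : ℝ) + 1) / ((b : ℝ) - 1)) ^ Fintype.card ι *
          ∑ k ∈ (Fintype.piFinset fun _ : ι => range (b ^ L)).erase 0, ‖c k‖ ^ 2 := by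
        rw [← Finset.mul_sum]
        field_simp

end Nets

end Literature.Analysis.Quadrature

end
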